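import Summits.Ventures.PercRepro.RankLevelSetBiIndepAbsorbNormSkew
import Summits.Ventures.PercRepro.RankLevelSetBiIndepMonoParallel

/-! # RankLevelSetBiIndepAbsorbParallel — (ABS-norm) IS CLOSED UNDER PARALLEL EXTENSION: THE GENERAL CASE IS THE
SIMPLE CASE (night-1 g32; dossier §44.2)

For a parallel pair `{y, z}` of `M` and `N = M ／ {y} ＼ {z}` (on `#E − 2` elements), every bi-independent set of `M`
contains exactly one of `y, z` (g25), and the absorbing avoid-`x` profile splits accordingly: for `x ∉ {y, z}`,
`A^x_{j+1}(M) = 2·A^x_j(N)` (`T ∪ {y}` and `T ∪ {z}` absorb `x` in `M` exactly when `T` absorbs `x` in `N`: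
**`lowAbsorbCount_succ_of_parallel`**), while for `x ∈ {y, z}` the absorbing avoid-`x` sets are exactly the
bi-independent sets through the other element of the pair, `A^x_{j+1}(M) = D_j(N)`
(**`lowAbsorbCount_succ_of_parallel_left`** / **`_right`**), and `A^x_0(M) = 0`. g31's `normSkew_shift` (a shift by one
adds two to the parameter) then gives **`absorbNormSkew_of_parallel`**: (ABS-norm) and Mono of `N` give (ABS-norm) of
`M` — so, as for (★★) (g25), (CUM-norm) (g30) and NHR (g31), a counterexample to (ABS-norm) inside the Mono-class can
be taken SIMPLE (and, with `RankLevelSetBiIndepAbsorbNormSkewSum`, connected). Every declaration has a docstring;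
imports: the cell's own modules and Mathlib only. Axioms: standard. -/

namespace PercRepro

open Set Matroid

variable {α : Type} (M : Matroid α) [M.Finite]

/-- With a parallel pair there is no absorbing `0`-set. -/
lemma lowAbsorbCount_zero_of_parallel {y z : α} (h : ParallelPair M y z) (x : α) :
    lowAbsorbCount M x 0 = 0 := by
  unfold lowAbsorbCount
  have : lowAbsorbAt M x 0 = ∅ := by
    rw [Set.eq_empty_iff_forall_notMem]
    intro Z hZ
    have := hZ.1
    rw [biIndep_zero_eq_empty M h] at this
    exact this
  rw [this, Set.ncard_empty]

omit [M.Finite] in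
/-- The `y`-fibre of the absorbing avoid-`x` sets (`x ∉ {y, z}`) is the absorbing avoid-`x` family of `N`. -/
lemma absorb_fibre_left_eq {y z x : α} (h : ParallelPair M y z) (hxy : x ≠ y) (hxz : x ≠ z) (j : ℕ) :
    {T ∈ biIndep ((M.contract {y}).delete {z}) j | x ∉ insert y T ∧ ¬ M.Indep (insert x (insert y T))} =
      lowAbsorbAt ((M.contract {y}).delete {z}) x j := by
  ext T
  simp only [lowAbsorbAt, Set.mem_setOf_eq]
  refine and_congr_right fun hT => ?_
  have hTE : T ⊆ ((M.contract {y}).delete {z}).E := hT.1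
  rw [ground_contract_delete] at hTE
  have hyT : y ∉ T := fun hy => (hTE hy).2 (Or.inl rfl)
  have hzT : z ∉ T := fun hz => (hTE hz).2 (Or.inr rfl)
  have e1 : x ∉ insert y T ↔ x ∉ T := by simp only [Set.mem_insert_iff, hxy, false_or]
  rw [e1, Set.insert_comm, indep_contract_delete_iff M h]
  refine and_congr_right fun _ => ?_
  have hyX : y ∉ insert x T := by
    simp only [Set.mem_insert_iff, not_or]; exact ⟨fun e => hxy e.symm, hyT⟩
  have hzX : z ∉ insert x T := by
    simp only [Set.mem_insert_iff, not_or]; exact ⟨fun e => hxz e.symm, hzT⟩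
  constructor
  · intro hdep hind; exact hdep hind.2
  · intro hdep hind; exact hdep ⟨⟨hyX, hzX⟩, hind⟩

omit [M.Finite] in
/-- The `z`-fibre of the absorbing avoid-`x` sets (`x ∉ {y, z}`) is the absorbing avoid-`x` family of `N`. -/
lemma absorb_fibre_right_eq {y z x : α} (h : ParallelPair M y z) (hxy : x ≠ y) (hxz : x ≠ z) (j : ℕ) :
    {T ∈ biIndep ((M.contract {y}).delete {z}) j | x ∉ insert z T ∧ ¬ M.Indep (insert x (insert z T))} =
      lowAbsorbAt ((M.contract {y}).delete {z}) x j := by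
  ext T
  simp only [lowAbsorbAt, Set.mem_setOf_eq]
  refine and_congr_right fun hT => ?_
  have hTE : T ⊆ ((M.contract {y}).delete {z}).E := hT.1
  rw [ground_contract_delete] at hTE
  have hyT : y ∉ T := fun hy => (hTE hy).2 (Or.inl rfl)
  have hzT : z ∉ T := fun hz => (hTE hz).2 (Or.inr rfl)
  have e1 : x ∉ insert z T ↔ x ∉ T := by simp only [Set.mem_insert_iff, hxz, false_or]
  rw [e1, Set.insert_comm, indep_contract_delete_iff' M h]
  refine and_congr_right fun _ => ?_
  have hyX : y ∉ insert x T := by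
    simp only [Set.mem_insert_iff, not_or]; exact ⟨fun e => hxy e.symm, hyT⟩
  have hzX : z ∉ insert x T := by
    simp only [Set.mem_insert_iff, not_or]; exact ⟨fun e => hxz e.symm, hzT⟩
  constructor
  · intro hdep hind; exact hdep hind.2
  · intro hdep hind; exact hdep ⟨⟨hzX, hyX⟩, hind⟩

/-- **`A^x_{j+1}(M) = 2·A^x_j(N)` for `x ∉ {y, z}`.** -/
lemma lowAbsorbCount_succ_of_parallel {y z x : α} (h : ParallelPair M y z) (hxy : x ≠ y) (hxz : x ≠ z) (j : ℕ) :
    lowAbsorbCount M x (j + 1) = 2 * lowAbsorbCount ((M.contract {y}).delete {z}) x j := by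
  have hsplit := ncard_biIndep_split M h (j + 1) (fun S => x ∉ S ∧ ¬ M.Indep (insert x S))
  have hl := ncard_biIndep_mem_left_eq M h j (fun S => x ∉ S ∧ ¬ M.Indep (insert x S))
  have hr := ncard_biIndep_mem_right_eq M h j (fun S => x ∉ S ∧ ¬ M.Indep (insert x S))
  unfold lowAbsorbCount
  have e0 : lowAbsorbAt M x (j + 1) = {S ∈ biIndep M (j + 1) | x ∉ S ∧ ¬ M.Indep (insert x S)} := rfl
  rw [e0, hsplit, hl, hr, absorb_fibre_left_eq M h hxy hxz j, absorb_fibre_right_eq M h hxy hxz j]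
  ring

/-- **`A^y_{j+1}(M) = D_j(N)`**: the absorbing avoid-`y` sets are the bi-independent sets through `z`. -/
lemma lowAbsorbCount_succ_of_parallel_left {y z : α} (h : ParallelPair M y z) (j : ℕ) :
    lowAbsorbCount M y (j + 1) = biIndepCount ((M.contract {y}).delete {z}) j := by
  have hsplit := ncard_biIndep_split M h (j + 1) (fun S => y ∉ S ∧ ¬ M.Indep (insert y S))
  have hl := ncard_biIndep_mem_left_eq M h j (fun S => y ∉ S ∧ ¬ M.Indep (insert y S))
  have hr := ncard_biIndep_mem_right_eq M h j (fun S => y ∉ S ∧ ¬ M.Indep (insert y S))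
  unfold lowAbsorbCount biIndepCount
  have e0 : lowAbsorbAt M y (j + 1) = {S ∈ biIndep M (j + 1) | y ∉ S ∧ ¬ M.Indep (insert y S)} := rfl
  have eL : {T ∈ biIndep ((M.contract {y}).delete {z}) j | y ∉ insert y T ∧ ¬ M.Indep (insert y (insert y T))}
      = ∅ := by
    rw [Set.eq_empty_iff_forall_notMem]
    rintro T ⟨-, hy, -⟩
    exact hy (Set.mem_insert y T)
  have eR : {T ∈ biIndep ((M.contract {y}).delete {z}) j | y ∉ insert z T ∧ ¬ M.Indep (insert y (insert z T))}
      = biIndep ((M.contract {y}).delete {z}) j := by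
    ext T
    simp only [Set.mem_setOf_eq, and_iff_left_iff_imp]
    intro hT
    have hTE : T ⊆ ((M.contract {y}).delete {z}).E := hT.1
    rw [ground_contract_delete] at hTE
    have hyT : y ∉ T := fun hy => (hTE hy).2 (Or.inl rfl)
    refine ⟨?_, fun hind => h.2.2.2 (hind.subset ?_)⟩
    · simp only [Set.mem_insert_iff, not_or]; exact ⟨h.1, hyT⟩
    · intro w hw
      rcases hw with rfl | rfl
      · exact Set.mem_insert _ _
      · exact Set.mem_insert_of_mem _ (Set.mem_insert _ _)
  rw [e0, hsplit, hl, hr, eL, eR, Set.ncard_empty, Nat.zero_add]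

/-- **`A^z_{j+1}(M) = D_j(N)`**: the absorbing avoid-`z` sets are the bi-independent sets through `y`. -/
lemma lowAbsorbCount_succ_of_parallel_right {y z : α} (h : ParallelPair M y z) (j : ℕ) :
    lowAbsorbCount M z (j + 1) = biIndepCount ((M.contract {y}).delete {z}) j := by
  have hsplit := ncard_biIndep_split M h (j + 1) (fun S => z ∉ S ∧ ¬ M.Indep (insert z S))
  have hl := ncard_biIndep_mem_left_eq M h j (fun S => z ∉ S ∧ ¬ M.Indep (insert z S))
  have hr := ncard_biIndep_mem_right_eq M h j (fun S => z ∉ S ∧ ¬ M.Indep (insert z S))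
  unfold lowAbsorbCount biIndepCount
  have e0 : lowAbsorbAt M z (j + 1) = {S ∈ biIndep M (j + 1) | z ∉ S ∧ ¬ M.Indep (insert z S)} := rfl
  have eR : {T ∈ biIndep ((M.contract {y}).delete {z}) j | z ∉ insert z T ∧ ¬ M.Indep (insert z (insert z T))}
      = ∅ := by
    rw [Set.eq_empty_iff_forall_notMem]
    rintro T ⟨-, hz, -⟩
    exact hz (Set.mem_insert z T)
  have eL : {T ∈ biIndep ((M.contract {y}).delete {z}) j | z ∉ insert y T ∧ ¬ M.Indep (insert z (insert y T))}
      = biIndep ((M.contract {y}).delete {z}) j := by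
    ext T
    simp only [Set.mem_setOf_eq, and_iff_left_iff_imp]
    intro hT
    have hTE : T ⊆ ((M.contract {y}).delete {z}).E := hT.1
    rw [ground_contract_delete] at hTE
    have hzT : z ∉ T := fun hz => (hTE hz).2 (Or.inr rfl)
    refine ⟨?_, fun hind => h.2.2.2 (hind.subset ?_)⟩
    · simp only [Set.mem_insert_iff, not_or]; exact ⟨fun e => h.1 e.symm, hzT⟩
    · intro w hw
      rcases hw with rfl | rfl
      · exact Set.mem_insert_of_mem _ (Set.mem_insert _ _)
      · exact Set.mem_insert _ _
  rw [e0, hsplit, hl, hr, eL, eR, Set.ncard_empty, Nat.add_zero]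

/-- **(ABS-norm) IS CLOSED UNDER PARALLEL EXTENSION**: for a parallel pair `{y, z}` and `N = M ／ {y} ＼ {z}`,
(ABS-norm) of `N` and Mono of `N` give (ABS-norm) of `M` (`normSkew_shift`: the shift adds two to the parameter
`#E − 2`). -/
theorem absorbNormSkew_of_parallel {y z : α} (h : ParallelPair M y z)
    (hN : BiIndepAbsorbNormSkew ((M.contract {y}).delete {z}))
    (hNm : BiIndepMono ((M.contract {y}).delete {z})) : BiIndepAbsorbNormSkew M := by
  haveI : ((M.contract {y}).delete {z}).Finite :=
    ⟨M.ground_finite.subset (by rw [ground_contract_delete]; exact Set.sdiff_subset)⟩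
  have hcard := ncard_ground_contract_delete M h
  have hn2 : 2 ≤ M.E.ncard := by
    have := Set.ncard_le_ncard (Set.pair_subset h.2.1.mem_ground h.2.2.1.mem_ground) M.ground_finite
    rwa [Set.ncard_pair h.1] at this
  have hD : SkewConv.NormSkew (biIndepCount ((M.contract {y}).delete {z})) (M.E.ncard - 2) := by
    have := normSkew_biIndepCount_of_mono _ hNm
    rwa [hcard] at this
  have hDs : SkewConv.NormSkew (SkewConv.shiftSeq (biIndepCount ((M.contract {y}).delete {z})) 1) M.E.ncard := by
    have := SkewConv.normSkew_shift hD 1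
    rwa [show M.E.ncard - 2 + 2 * 1 = M.E.ncard by omega] at this
  intro x hx
  by_cases hxy : x = y
  · subst hxy
    refine SkewConv.normSkew_congr hDs fun k _ => ?_
    cases k with
    | zero => simp [SkewConv.shiftSeq, lowAbsorbCount_zero_of_parallel M h]
    | succ j =>
      rw [lowAbsorbCount_succ_of_parallel_left M h j]
      simp only [SkewConv.shiftSeq, Nat.succ_le_succ_iff, Nat.zero_le, if_true, Nat.add_sub_cancel]
  by_cases hxz : x = z
  · subst hxz
    refine SkewConv.normSkew_congr hDs fun k _ => ?_
    cases k with
    | zero => simp [SkewConv.shiftSeq, lowAbsorbCount_zero_of_parallel M h]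
    | succ j =>
      rw [lowAbsorbCount_succ_of_parallel_right M h j]
      simp only [SkewConv.shiftSeq, Nat.succ_le_succ_iff, Nat.zero_le, if_true, Nat.add_sub_cancel]
  · have hxN : x ∈ ((M.contract {y}).delete {z}).E := by
      rw [ground_contract_delete]
      exact ⟨hx, by simp only [Set.mem_insert_iff, Set.mem_singleton_iff, not_or]; exact ⟨hxy, hxz⟩⟩
    have hA : SkewConv.NormSkew (lowAbsorbCount ((M.contract {y}).delete {z}) x) (M.E.ncard - 2) := by
      have := hN x hxN
      rwa [hcard] at this
    have hAs : SkewConv.NormSkew (SkewConv.shiftSeq (lowAbsorbCount ((M.contract {y}).delete {z}) x) 1)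
        M.E.ncard := by
      have := SkewConv.normSkew_shift hA 1
      rwa [show M.E.ncard - 2 + 2 * 1 = M.E.ncard by omega] at this
    refine SkewConv.normSkew_congr (SkewConv.normSkew_add hAs hAs) fun k _ => ?_
    cases k with
    | zero => simp [SkewConv.shiftSeq, lowAbsorbCount_zero_of_parallel M h]
    | succ j =>
      rw [lowAbsorbCount_succ_of_parallel M h hxy hxz j]
      simp only [SkewConv.shiftSeq, Nat.succ_le_succ_iff, Nat.zero_le, if_true, Nat.add_sub_cancel]
      ring

end PercRepro
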